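import Summits.KontsevichZagierPeriods.Zeta5Search.DenomLaw.OrbitCreditCasoratian

/-!
# ζ(5) search — DENOM-LAW track D3 (denom-theory-d3 g4): the H* increment — LAYER 1 proved (`noExtremalUnderH_holds`), LAYER 2 split into the single-pole and the multi-pole floor case

Third file of the seat file `HOME/denom-law/code/d3g4/lean/OrbitCredit.lean` (v5, sha256 2da4185d…; author denom-theory-d3 g4, a planner seat;
filed by the prover seat denom-engine-d2 g4 with the tree's names: `LoopAndPair` for the H* predicate as stated, `OrbitFloorHStar` for the H* floor
conjecture — see the revision note in `DenomLaw/OrbitCredit.lean`).  Content = the seat file's v4 block verbatim up to these renamings: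
`card_le_pairFloors`, `one_le_pairTerm_cross`, **`noExtremalUnderH_holds : NoExtremalUnderH`** (under LoopAndPair no class is extremal — whole window),
the two floor cases `FloorLayerSingleH` / `FloorLayerMultiH` (CONJECTURED here; (S) is proved in `DenomLaw/OrbitCreditHSingle.lean`; paper proofs
SYMMETRY-D3 §9.9.4), `floorLayerCreditedUnderH_of_cases`, `orbitFloorHStar_of_floorCases`, and the block-count helper lemmas used by case (S).
HONEST FRAMING: systematic search; combinatorial statements about the pole classes of the cell's dual series and a p-adic valuation consequence;
the exactness rates quoted in `OrbitCredit.lean` are MODEL-side data; nothing about ζ(5); no γ moves; no irrationality claim; records in print UNMOVED.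
-/

open Finset
open Summit.KontsevichZagierPeriods.Zeta5Search.WedgeDictionary (coeffV pfData dOf)
open Summit.KontsevichZagierPeriods.Zeta5Search.CasoratianValuation (InPolytope pairFloors shift casoratian)

namespace Summit.KontsevichZagierPeriods.Zeta5Search.ClusterValuation.Orbit

open Summit.KontsevichZagierPeriods.Zeta5Search.ClusterValuation
open Summit.KontsevichZagierPeriods.Zeta5Search.PadicSeries (one_le_p zpow_p_nonneg)
open Summit.KontsevichZagierPeriods.Zeta5Search.DualSeries (InBox)
open Summit.KontsevichZagierPeriods.Zeta5Search.BigPrime (shift_zero dOf_shift)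

/-! ### v4: LAYER 1 proved; LAYER 2 split into the single-pole and the multi-pole floor case (both CONJECTURED; paper proofs SYMMETRY-D3 §9.9.4) -/

/-- **Counting distinct large pairs**: a set `P` of index pairs `i < k < 7`, each with `⌊(b₀ − b_i − b_k)/p⌋ ≥ 1`, has `#P ≤ N_p`. -/
theorem card_le_pairFloors (b : ℕ → ℤ) (hb : InPolytope b) (p : ℕ) (P : Finset (ℕ × ℕ))
    (hP7 : ∀ e ∈ P, e.1 < e.2 ∧ e.2 < 7) (hP : ∀ e ∈ P, 1 ≤ pairTerm b p e.1 e.2) :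
    (P.card : ℤ) ≤ pairFloors b p := by
  have hsub : P ⊆ range 7 ×ˢ range 7 := by
    intro e he
    have := hP7 e he
    rw [mem_product, mem_range, mem_range]
    omega
  have hNp : pairFloors b p = ∑ e ∈ range 7 ×ˢ range 7, (if e.1 < e.2 then pairTerm b p e.1 e.2 else 0) := by
    rw [sum_product]; rfl
  rw [hNp]
  calc (P.card : ℤ) = ∑ e ∈ P, (1 : ℤ) := by simp
    _ ≤ ∑ e ∈ P, (if e.1 < e.2 then pairTerm b p e.1 e.2 else 0) := by
        refine sum_le_sum fun e he => ?_
        rw [if_pos (hP7 e he).1]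
        exact hP e he
    _ ≤ ∑ e ∈ range 7 ×ˢ range 7, (if e.1 < e.2 then pairTerm b p e.1 e.2 else 0) := by
        refine sum_le_sum_of_subset_of_nonneg hsub fun e he _ => ?_
        have h7 := mem_product.1 he
        split_ifs
        · exact pairTerm_nonneg b hb p (mem_range.1 h7.1) (mem_range.1 h7.2)
        · exact le_rfl

/-- **Cross pairs are large**: if `x ∈ B_a` and `v ∈ B_e` with `v ≥ x + p`, then `⌊(b₀ − b_a − b_e)/p⌋ ≥ 1`. -/
theorem one_le_pairTerm_cross (b : ℕ → ℤ) (hb : InPolytope b) {p x v a e : ℕ} (hp : 0 < p) (ha7 : a < 7) (he7 : e < 7)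
    (ha : x ∈ blk b a) (he : v ∈ blk b e) (hv : x + p ≤ v) : 1 ≤ pairTerm b p (min a e) (max a e) := by
  have h0 : 0 ≤ b 0 := hb.1.1
  have hβa : 0 ≤ b (a + 1) := (hb.1.2 a (mem_range.2 ha7)).1
  have hβe : 0 ≤ b (e + 1) := (hb.1.2 e (mem_range.2 he7)).1
  have hb0 : (((b 0).toNat : ℕ) : ℤ) = b 0 := Int.toNat_of_nonneg h0
  have hba : (((b (a + 1)).toNat : ℕ) : ℤ) = b (a + 1) := Int.toNat_of_nonneg hβa
  have hbe : (((b (e + 1)).toNat : ℕ) : ℤ) = b (e + 1) := Int.toNat_of_nonneg hβe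
  have ha' := ((mem_blk b a x).1 ha).1
  have he' := ((mem_blk b e v).1 he).2
  have hp' : (0 : ℤ) < (p : ℤ) := by exact_mod_cast hp
  have hkey : (p : ℤ) * 1 ≤ b 0 - b (a + 1) - b (e + 1) := by
    have h1 : (b (e + 1)).toNat + v ≤ (b 0).toNat := by omega
    have h2 : ((b (e + 1)).toNat : ℤ) + (v : ℤ) ≤ ((b 0).toNat : ℤ) := by exact_mod_cast h1
    have h3 : ((b (a + 1)).toNat : ℤ) ≤ (x : ℤ) := by exact_mod_cast ha'
    have h4 : (x : ℤ) + (p : ℤ) ≤ (v : ℤ) := by exact_mod_cast hv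
    linarith
  rcases le_total a e with hae | hea
  · rw [min_eq_left hae, max_eq_right hae]
    unfold pairTerm
    exact Int.le_ediv_of_mul_le hp' (by linarith)
  · rw [min_eq_right hea, max_eq_left hea]
    unfold pairTerm
    exact Int.le_ediv_of_mul_le hp' (by linarith)

set_option maxHeartbeats 400000 in
/-- **LAYER 1 IS A THEOREM (v4)**: under LoopAndPair no class is extremal.  The extremal shapes `(−1,−1)`/`N = 1` and `(−2,−2)`/`N = 3`
(`classExpRigidity_holds`) come with 1 resp. 3 large CROSS pairs between the blocks through `x` (`b_a ≤ x < p`) and the blocks through the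
other pole `v ≥ x + p`; the H-vertex `j` has `b_j ≥ p > x`, so its large pair is none of them, and counting distinct large pairs
(`card_le_pairFloors`) gives `N ≥ 2` resp. `N ≥ 4`.  SYMMETRY-D3 §9.9.3. -/
theorem noExtremalUnderH_holds : NoExtremalUnderH := by
  intro b p x hb hprime hp5 hpb hwin hH hx hcount hE
  have hp0 : 0 < p := hprime.pos
  have h0 : 0 ≤ b 0 := hb.1.1
  have hb0 : (((b 0).toNat : ℕ) : ℤ) = b 0 := Int.toNat_of_nonneg h0
  have hodd : ¬ 2 ∣ p := by
    intro h2
    have := (Nat.prime_dvd_prime_iff_eq Nat.prime_two hprime).1 h2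
    omega
  obtain ⟨hcard, -, hshape⟩ := classExpRigidity_holds b p x hb hp5 hodd hpb hwin hx hcount hE
  -- the two class points: `x` and some `v ≥ x + p`
  have hxmem : x ∈ classSet b p x := by
    unfold classSet
    rw [mem_filter, mem_range]
    refine ⟨?_, rfl⟩
    have : (x : ℤ) < (p : ℤ) := by exact_mod_cast hx
    omega
  obtain ⟨v, hvmem, hvx⟩ : ∃ v ∈ classSet b p x, v ≠ x := by
    have h1 : 1 < (classSet b p x).card := by omega
    obtain ⟨a, ha, c, hc, hac⟩ := one_lt_card.1 h1
    by_cases hax : a = x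
    · exact ⟨c, hc, fun h => hac (hax.trans h.symm)⟩
    · exact ⟨a, ha, hax⟩
  have hv : x + p ≤ v := by
    have hres : v % p = x % p := (mem_filter.1 hvmem).2
    have hxp : x % p = x := Nat.mod_eq_of_lt hx
    have h1 := Nat.div_add_mod v p
    rcases Nat.eq_zero_or_pos (v / p) with h0' | hq
    · rw [h0', mul_zero, zero_add, hres, hxp] at h1
      exact absurd h1.symm hvx
    · have := Nat.mul_le_mul_left p (show 1 ≤ v / p from hq)
      rw [hres, hxp] at h1
      linarith
  -- the H pair `(J, K)` (0-based), `J ∉` blocks through `x`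
  obtain ⟨j, hj, hloop, k, hk, hkj, hpair⟩ := hH
  rw [Finset.mem_Icc] at hj hk
  set J := j - 1 with hJ
  set K := k - 1 with hK
  have hJ7 : J < 7 := by omega
  have hK7 : K < 7 := by omega
  have hJK : J ≠ K := by omega
  have hxJ : x ∉ blk b J := by
    intro h
    have h1 := ((mem_blk b J x).1 h).1
    have hβ : 0 ≤ b (J + 1) := (hb.1.2 J (mem_range.2 hJ7)).1
    have h2 : (((b (J + 1)).toNat : ℕ) : ℤ) = b (J + 1) := Int.toNat_of_nonneg hβ
    have h3 : J + 1 = j := by omega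
    have hloop' : (p : ℤ) ≤ b (J + 1) := by rw [h3]; exact hloop
    have h4 : (((b (J + 1)).toNat : ℕ) : ℤ) ≤ (x : ℤ) := by exact_mod_cast h1
    have h5 : (x : ℤ) < (p : ℤ) := by exact_mod_cast hx
    linarith
  have hJKterm : 1 ≤ pairTerm b p (min J K) (max J K) := by
    have hp' : (0 : ℤ) < (p : ℤ) := by exact_mod_cast hp0
    rcases Nat.lt_or_gt_of_ne hkj with h | h
    · rw [min_eq_right (by omega : K ≤ J), max_eq_left (by omega : K ≤ J)]
      unfold pairTerm
      rw [show K + 1 = k by omega, show J + 1 = j by omega]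
      exact Int.le_ediv_of_mul_le hp' (by linarith)
    · rw [min_eq_left (by omega : J ≤ K), max_eq_right (by omega : J ≤ K)]
      unfold pairTerm
      rw [show K + 1 = k by omega, show J + 1 = j by omega]
      exact Int.le_ediv_of_mul_le hp' (by linarith)
  -- blocks through `x` and through `v`
  set Sx := (range 7).filter fun a => x ∈ blk b a with hSx
  set Sv := (range 7).filter fun e => v ∈ blk b e with hSv
  have hSxc : Sx.card = blockCount b x := (blockCount_eq b x).symm
  have hSvc : Sv.card = blockCount b v := (blockCount_eq b v).symm
  have hJSx : J ∉ Sx := fun h => hxJ (mem_filter.1 h).2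
  have memSx : ∀ a ∈ Sx, a < 7 ∧ x ∈ blk b a := fun a ha => ⟨mem_range.1 (mem_filter.1 ha).1, (mem_filter.1 ha).2⟩
  have memSv : ∀ e ∈ Sv, e < 7 ∧ v ∈ blk b e := fun e he => ⟨mem_range.1 (mem_filter.1 he).1, (mem_filter.1 he).2⟩
  -- depth lower bounds from the shapes
  have hbc : ∀ s ∈ classSet b p x, ∀ m : ℕ, netExp b s = -(m : ℤ) → m + 1 ≤ blockCount b s := by
    intro s _ m h
    unfold netExp at h
    split_ifs at h <;> omega
  rcases hshape with ⟨hN, hall⟩ | ⟨hN, hall⟩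
  · -- shape (−1,−1), N = 1: two distinct large pairs
    have hx2 : 2 ≤ Sx.card := by rw [hSxc]; exact hbc x hxmem 1 (by rw [hall x hxmem]; norm_num)
    have hv2 : 2 ≤ Sv.card := by rw [hSvc]; exact hbc v hvmem 1 (by rw [hall v hvmem]; norm_num)
    obtain ⟨a, ha⟩ : (Sx.erase K).Nonempty := by
      rw [← card_pos]; have := pred_card_le_card_erase (s := Sx) (a := K); omega
    have haK : a ≠ K := (mem_erase.1 ha).1
    have haSx := mem_of_mem_erase ha
    obtain ⟨ha7, hxa⟩ := memSx a haSx
    have haJ : a ≠ J := fun h => hJSx (h ▸ haSx)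
    obtain ⟨e, he⟩ : (Sv.erase a).Nonempty := by
      rw [← card_pos]; have := pred_card_le_card_erase (s := Sv) (a := a); omega
    have hea : e ≠ a := (mem_erase.1 he).1
    obtain ⟨he7, hve⟩ := memSv e (mem_of_mem_erase he)
    have hcross := one_le_pairTerm_cross b hb hp0 ha7 he7 hxa hve hv
    have hcount := card_le_pairFloors b hb p {(min a e, max a e), (min J K, max J K)}
      (by
        intro q hq
        rw [mem_insert, mem_singleton] at hq
        rcases hq with rfl | rfl
        · simp only; omega
        · simp only; omega)
      (by
        intro q hq
        rw [mem_insert, mem_singleton] at hq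
        rcases hq with rfl | rfl
        · exact hcross
        · exact hJKterm)
    have hc2 : ({(min a e, max a e), (min J K, max J K)} : Finset (ℕ × ℕ)).card = 2 := by
      rw [card_insert_of_notMem, card_singleton]
      rw [mem_singleton, Prod.mk.injEq]
      omega
    rw [hc2] at hcount
    push_cast at hcount
    linarith
  · -- shape (−2,−2), N = 3: four distinct large pairs
    have hx3 : 3 ≤ Sx.card := by rw [hSxc]; exact hbc x hxmem 2 (by rw [hall x hxmem]; norm_num)
    have hv3 : 3 ≤ Sv.card := by rw [hSvc]; exact hbc v hvmem 2 (by rw [hall v hvmem]; norm_num)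
    obtain ⟨a₁, ha₁⟩ : (Sx.erase K).Nonempty := by
      rw [← card_pos]; have := pred_card_le_card_erase (s := Sx) (a := K); omega
    have ha₁K : a₁ ≠ K := (mem_erase.1 ha₁).1
    have ha₁Sx := mem_of_mem_erase ha₁
    obtain ⟨ha₁7, hxa₁⟩ := memSx a₁ ha₁Sx
    have ha₁J : a₁ ≠ J := fun h => hJSx (h ▸ ha₁Sx)
    obtain ⟨a₂, ha₂⟩ : ((Sx.erase K).erase a₁).Nonempty := by
      rw [← card_pos]
      have h1 := pred_card_le_card_erase (s := Sx) (a := K)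
      have h2 := card_erase_of_mem ha₁
      omega
    have ha₂a₁ : a₂ ≠ a₁ := (mem_erase.1 ha₂).1
    have ha₂K : a₂ ≠ K := (mem_erase.1 (mem_of_mem_erase ha₂)).1
    have ha₂Sx := mem_of_mem_erase (mem_of_mem_erase ha₂)
    obtain ⟨ha₂7, hxa₂⟩ := memSx a₂ ha₂Sx
    have ha₂J : a₂ ≠ J := fun h => hJSx (h ▸ ha₂Sx)
    obtain ⟨e₁, he₁⟩ : (Sv.erase a₁).Nonempty := by
      rw [← card_pos]; have := pred_card_le_card_erase (s := Sv) (a := a₁); omega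
    have he₁a₁ : e₁ ≠ a₁ := (mem_erase.1 he₁).1
    obtain ⟨he₁7, hve₁⟩ := memSv e₁ (mem_of_mem_erase he₁)
    obtain ⟨e₂, he₂⟩ : ((Sv.erase a₁).erase e₁).Nonempty := by
      rw [← card_pos]
      have h1 := pred_card_le_card_erase (s := Sv) (a := a₁)
      have h2 := card_erase_of_mem he₁
      omega
    have he₂e₁ : e₂ ≠ e₁ := (mem_erase.1 he₂).1
    have he₂a₁ : e₂ ≠ a₁ := (mem_erase.1 (mem_of_mem_erase he₂)).1
    obtain ⟨he₂7, hve₂⟩ := memSv e₂ (mem_of_mem_erase (mem_of_mem_erase he₂))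
    obtain ⟨e₃, he₃⟩ : ((Sv.erase a₁).erase a₂).Nonempty := by
      rw [← card_pos]
      have h1 := pred_card_le_card_erase (s := Sv) (a := a₁)
      have h2 := pred_card_le_card_erase (s := Sv.erase a₁) (a := a₂)
      omega
    have he₃a₂ : e₃ ≠ a₂ := (mem_erase.1 he₃).1
    have he₃a₁ : e₃ ≠ a₁ := (mem_erase.1 (mem_of_mem_erase he₃)).1
    obtain ⟨he₃7, hve₃⟩ := memSv e₃ (mem_of_mem_erase (mem_of_mem_erase he₃))
    have hc₁ := one_le_pairTerm_cross b hb hp0 ha₁7 he₁7 hxa₁ hve₁ hv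
    have hc₂ := one_le_pairTerm_cross b hb hp0 ha₁7 he₂7 hxa₁ hve₂ hv
    have hc₃ := one_le_pairTerm_cross b hb hp0 ha₂7 he₃7 hxa₂ hve₃ hv
    have hcount := card_le_pairFloors b hb p
      {(min a₁ e₁, max a₁ e₁), (min a₁ e₂, max a₁ e₂), (min a₂ e₃, max a₂ e₃), (min J K, max J K)}
      (by
        intro q hq
        simp only [mem_insert, mem_singleton] at hq
        rcases hq with rfl | rfl | rfl | rfl <;> (simp only; omega))
      (by
        intro q hq
        simp only [mem_insert, mem_singleton] at hq
        rcases hq with rfl | rfl | rfl | rfl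
        · exact hc₁
        · exact hc₂
        · exact hc₃
        · exact hJKterm)
    have hc4 : ({(min a₁ e₁, max a₁ e₁), (min a₁ e₂, max a₁ e₂), (min a₂ e₃, max a₂ e₃), (min J K, max J K)} :
        Finset (ℕ × ℕ)).card = 4 := by
      rw [card_insert_of_notMem, card_insert_of_notMem, card_insert_of_notMem, card_singleton]
      · rw [mem_singleton, Prod.mk.injEq]; omega
      · simp only [mem_insert, mem_singleton, Prod.mk.injEq]; omega
      · simp only [mem_insert, mem_singleton, Prod.mk.injEq]; omega
    rw [hc4] at hcount
    push_cast at hcount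
    linarith

/-- **LAYER 2, single-pole case — A THEOREM (v5: `floorLayerSingleH_holds` below; paper proof SYMMETRY-D3 §9.9.4 case (S))**: a NON-TAME
single-pole class at the floor under LoopAndPair is `{x, x+p, x+2p}` with a pole of order 6 in the middle (shape `(0,−6,0)`, `N = 6`), hence credited.
(The `@[conjecture]` tag is kept only so that the v4 reductions below refer to an unchanged declaration.) -/
@[conjecture] def FloorLayerSingleH : Prop :=
  ∀ (b : ℕ → ℤ) (p x : ℕ), InPolytope b → p.Prime → 5 ≤ p → (p : ℤ) ≤ b 0 → (b 0 + 2 : ℤ) < (p : ℤ) ^ 2 →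
    (p : ℤ) ≤ dOf b → dOf b < 2 * (p : ℤ) → mOne b < 2 * (p : ℤ) → LoopAndPair b p → x < p →
      classPoleCount b p x = 1 → tameSingle b p x = false → classExp b p x = -pairFloors b p → Credited b p x

/-- **LAYER 2, multi-pole case (CONJECTURED; paper proof SYMMETRY-D3 §9.9.4 case (T))**: a class with ≥ 2 poles at the floor under LoopAndPair
is `{x, x+p}` of shape `(−1,−1)`/`N = 2`, `(−2,−2)`/`N = 4` (or `(−3,−3)`/`N = 6`), hence credited. -/
@[conjecture] def FloorLayerMultiH : Prop :=
  ∀ (b : ℕ → ℤ) (p x : ℕ), InPolytope b → p.Prime → 5 ≤ p → (p : ℤ) ≤ b 0 → (b 0 + 2 : ℤ) < (p : ℤ) ^ 2 →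
    (p : ℤ) ≤ dOf b → dOf b < 2 * (p : ℤ) → mOne b < 2 * (p : ℤ) → LoopAndPair b p → x < p →
      2 ≤ classPoleCount b p x → classExp b p x = -pairFloors b p → Credited b p x

/-- Layer 2 is the conjunction of its two cases. -/
theorem floorLayerCreditedUnderH_of_cases (hS : FloorLayerSingleH) (hT : FloorLayerMultiH) : FloorLayerCreditedUnderH := by
  intro b p x hb hprime hp5 hpb hwin hd1 hd2 hm1 hH hx hpole htame hE
  by_cases h1 : classPoleCount b p x = 1
  · have hf : tameSingle b p x = false := by
      cases h : tameSingle b p x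
      · rfl
      · exact absurd ⟨h1, h⟩ htame
    exact hS b p x hb hprime hp5 hpb hwin hd1 hd2 hm1 hH hx h1 hf hE
  · exact hT b p x hb hprime hp5 hpb hwin hd1 hd2 hm1 hH hx (by omega) hE

/-- **`OrbitFloorHStar` now rests on the two floor cases only** (Layer 1 being proved). -/
theorem orbitFloorHStar_of_floorCases (hS : FloorLayerSingleH) (hT : FloorLayerMultiH) : OrbitFloorHStar :=
  orbitFloorHStar_of_layers noExtremalUnderH_holds (floorLayerCreditedUnderH_of_cases hS hT)

/-! ### Block-count helper lemmas (used by the single-pole floor case, `DenomLaw/OrbitCreditHSingle.lean`) -/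

/-- The centre lies in every block: `blockCount (b₀/2) = 7`. -/
theorem blockCount_centre (b : ℕ → ℤ) (hb : InPolytope b) {c : ℕ} (hc : 2 * (c : ℤ) = b 0) : blockCount b c = 7 := by
  rw [blockCount_eq]
  have : (range 7).filter (fun j => c ∈ blk b j) = range 7 := by
    refine filter_true_of_mem fun j hj => ?_
    have hj7 := mem_range.1 hj
    have hβ : 0 ≤ b (j + 1) := (hb.1.2 j hj).1
    have hh : 2 * b (j + 1) ≤ b 0 := hb.2.1 j hj
    have h0 : 0 ≤ b 0 := hb.1.1
    have hb0 : (((b 0).toNat : ℕ) : ℤ) = b 0 := Int.toNat_of_nonneg h0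
    have hbj : (((b (j + 1)).toNat : ℕ) : ℤ) = b (j + 1) := Int.toNat_of_nonneg hβ
    rw [mem_blk]
    constructor <;> omega
  rw [this, card_range]

/-- A point of net exponent `0` has depth exactly `1` (the even centre has depth 7, net `−5`). -/
theorem blockCount_eq_one_of_netExp_eq_zero (b : ℕ → ℤ) (hb : InPolytope b) {s : ℕ} (hs : netExp b s = 0) :
    blockCount b s = 1 := by
  unfold netExp at hs
  split_ifs at hs with hc
  · have := blockCount_centre b hb hc; omega
  · omega

/-- Two distinct blocks through a point give depth `≥ 2`. -/
theorem two_le_blockCount_of_mem (b : ℕ → ℤ) {s i k : ℕ} (hi : i < 7) (hk : k < 7) (hik : i ≠ k)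
    (hsi : s ∈ blk b i) (hsk : s ∈ blk b k) : 2 ≤ blockCount b s := by
  rw [blockCount_eq]
  have hsub : ({i, k} : Finset ℕ) ⊆ (range 7).filter (fun j => s ∈ blk b j) := by
    intro j hj
    rw [mem_insert, mem_singleton] at hj
    rw [mem_filter, mem_range]
    rcases hj with rfl | rfl
    · exact ⟨hi, hsi⟩
    · exact ⟨hk, hsk⟩
  have := card_le_card hsub
  rw [card_pair hik] at this
  exact this

/-- A pair value is at most `m₁`. -/
theorem pair_le_mOne (b : ℕ → ℤ) {i k : ℕ} (hi : i < 7) (hk : k < 7) (hik : i ≠ k) :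
    b 0 - b (i + 1) - b (k + 1) ≤ mOne b := by
  unfold mOne
  refine le_max_of_le_right ?_
  rcases Nat.lt_or_gt_of_ne hik with h | h
  · have hmem : (i + 1, k + 1) ∈ (Finset.Icc 1 7) ×ˢ (Finset.Icc 1 7) := by
      rw [mem_product, Finset.mem_Icc, Finset.mem_Icc]; omega
    have := Finset.le_sup' (fun jk : ℕ × ℕ => if jk.1 < jk.2 then b 0 - b jk.1 - b jk.2 else b 1) hmem
    simp only at this
    rw [if_pos (by omega : i + 1 < k + 1)] at this
    exact this
  · have hmem : (k + 1, i + 1) ∈ (Finset.Icc 1 7) ×ˢ (Finset.Icc 1 7) := by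
      rw [mem_product, Finset.mem_Icc, Finset.mem_Icc]; omega
    have := Finset.le_sup' (fun jk : ℕ × ℕ => if jk.1 < jk.2 then b 0 - b jk.1 - b jk.2 else b 1) hmem
    simp only at this
    rw [if_pos (by omega : k + 1 < i + 1)] at this
    linarith

end Summit.KontsevichZagierPeriods.Zeta5Search.ClusterValuation.Orbit
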